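import Literature.NumberTheory.PAdicHodge.LubinTateLogCoboundaries
import Literature.NumberTheory.PAdicHodge.LogLinearToMultiplicative
import Literature.NumberTheory.PAdicHodge.UnramifiedCharacterThetaPeriods
import Literature.NumberTheory.GaloisRepresentations.EmbeddingBasisCoefficientsProofs
import HarnessLib

/-!
# SoloInformedFontaineMazurGL1General — Tate's theorem "de Rham ⇒ locally algebraic" for rank-one
# `p`-adic representations of `Γ_F`, `F/ℚ_p` finite of ANY degree (solo-Langlands-informed s110, Stage D)

The tree's `DeRhamRankOne.exists_isOpen_eq_prod_of_isDeRhamFramed` proves the statement below only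
for `F` with `e(F/ℚ_p) = f(F/ℚ_p) = 1` (hypotheses `hπ : π = p`, `hq : q = p`, `hdeg`).  Here it is
proved for every finite `F/ℚ_p`, granting only the named Literature fact
(H) = `LubinTateCharacterConjugateAdmissible F p hp hπ` (the non-identity conjugates of the
Lubin–Tate character are `ℂ_F`-admissible on an open subgroup — Serre 1968 III.A.4–A.5 / Tate 1967
§3.3) for ONE uniformizer `π`:

★ `exists_isOpen_eq_prod_of_isDeRhamFramed_general`: for a de Rham (`fontainePst`) framed character
`r : Γ_F → GL_1(ℚ̄_p)` there are an open subgroup `V ⊆ Fˣ`, finitely many continuous embeddings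
`e : F → ℚ̄_p` and integers `n_e` with `r(w) = ∏_e e(Art_F w)^{n_e}` for all `w` in the inertia
subgroup of the Weil group with `Art_F(w) ∈ V`.

Proof (Serre 1968 Ch. III §A.1–A.7 made relative to `F`, everything inside `ℂ_F`): a model `r_E`
over a finite `E ⊆ ℚ̄_p` with its `B_dR`-periods (tree Λ44), `ψ = det r_E = μ · ν` with `μ`
unramified and `ν = ν̃ ∘ χ_π` (local Kronecker–Weber, tree Λ45), `log ν̃ = α ∘ log` near `1`
(tree Λ48); for every `ℚ_p`-embedding `j : E → F̄` the quotient of the `θ`-periods of `j ∘ ψ` and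
`j ∘ μ` (tree Λ44/Λ46) is a semi-invariant vector for `(j∘ν)⁻¹ χ^{a_j}`, whence by the log-coboundary
calculus (tree Λ49–Λ51: `[log χ] ≠ 0`, (Ω) `[log χ] = [log N(χ_π)]`, (H') `[log e(χ_π)] = 0` for
`e ≠ ι₀`) the `ι₀`-coefficient of `j ∘ α` is the integer `a_j` (tree Λ50); Galois descent over the
embeddings (tree Λ39) makes ALL coefficients of `j₀ ∘ α` integers `n_e`, and exponentiating (tree Λ52)
gives `j₀(ν̃ u) = ∏_e e(u)^{n_e}` near `1`; on inertia `r = ν̃ ∘ χ_π` and `χ_π(w) = Art_F(w)`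
(tree `coe_lubinTateChar_toAbsGalois_canonicalArtin`).

References: J.-P. Serre, *Abelian ℓ-adic representations and elliptic curves* (1968), Ch. III and
App. III.A [SerreAbelianLadic1968]; J. Tate, *p-divisible groups* (1967), §3.3 [Tate1967];
J.-M. Fontaine, Astérisque 223, Exp. III [FontaineAsterisque223III].
-/

noncomputable section

open NormedSpace IsUltrametricDist ValuativeRel Filter
open scoped Topology MatrixGroups

namespace Summit.Langlands.Langlands.Theorems

open Literature.NumberTheory.PAdicHodge
open Literature.NumberTheory.GaloisRepresentations
open Literature.NumberTheory.GaloisRepresentations.IsNonarchimedeanLocalField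
open Literature.NumberTheory.LocalFields
open Literature.NumberTheory.Transcendental
open Field PadicCompletedAlgClosure LogLinearCoefficients LocalKroneckerWeberLT EmbeddingCoefficients

set_option maxHeartbeats 1600000 in
/-- ★ **Tate's theorem (de Rham ⇒ locally algebraic) for rank one, `F/ℚ_p` finite of any degree**,
granting the named fact (H) `LubinTateCharacterConjugateAdmissible` for one uniformizer.
[cite: SerreAbelianLadic1968, Ch. III §A.5–A.7] [cite: Tate1967, §3.3 Thm. 2 and Cor. 2]
[cite: FontaineAsterisque223III, Exp. III §1.5] -/
theorem exists_isOpen_eq_prod_of_isDeRhamFramed_general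
    {F : Type} [Field F] [ValuativeRel F] [TopologicalSpace F] [IsNonarchimedeanLocalField F]
    [CharZero F] {p : ℕ} [Fact p.Prime] (hp : valuation F p < 1)
    {π : 𝒪[F]} (hπ : (valuation F).IsUniformizer (π : F))
    (hH : LubinTateCharacterConjugateAdmissible F p hp hπ)
    (r : FramedRep (absoluteGaloisGroup F) (PadicAlgCl p) 1)
    (hr : (fontainePst F p hp).IsDeRhamFramed r) :
    ∃ V : Subgroup Fˣ, IsOpen (V : Set Fˣ) ∧
      ∃ (s : Finset (F →+* PadicAlgCl p)) (n : (F →+* PadicAlgCl p) → ℤ),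
        (∀ e ∈ s, Continuous e) ∧ ∀ w ∈ WeilGroup.inertia F, canonicalArtin F w ∈ V →
          ((r (WeilGroup.toAbsGalois F w) : GL (Fin 1) (PadicAlgCl p)) :
              Matrix (Fin 1) (Fin 1) (PadicAlgCl p)) 0 0 =
            ∏ e ∈ s, e ((canonicalArtin F w : Fˣ) : F) ^ n e := by
  classical
  letI := LocalField.padicAlgebra F p hp
  haveI := PadicField.finiteDimensional F p hp
  haveI : Fact (¬ IsUnit ((p : ℕ) : integerC F)) := ⟨not_isUnit_natCast_integerC hp⟩
  haveI : IsAdicComplete (Ideal.span {((p : ℕ) : integerC F)}) (integerC F) :=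
    isAdicComplete_integerC_natCast hp
  set K := PadicCompletedAlgClosure F p hp
  set ι₀ : F →ₐ[ℚ_[p]] AlgebraicClosure F := IsScalarTower.toAlgHom ℚ_[p] F (AlgebraicClosure F)
    with hι₀
  -- (1) a model over a finite `E ⊆ ℚ̄_p` with its `θ`-periods at every embedding
  obtain ⟨E, hEfd, rE, hmodel, hper⟩ :=
    DeRhamRankOne.exists_model_theta_periods_of_isDeRhamFramed hp r hr
  haveI := hEfd
  haveI : CompleteSpace E := FiniteDimensional.complete ℚ_[p] E
  -- (2) the character `ψ = det r_E : Γ_F → Eˣ`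
  set ψ : absoluteGaloisGroup F →* (E)ˣ :=
    (Matrix.GeneralLinearGroup.det : GL (Fin 1) E →* (E)ˣ).comp rE.toMonoidHom with hψdef
  have hψ00 : ∀ σ, ((ψ σ : (E)ˣ) : E) =
      ((rE σ : GL (Fin 1) E) : Matrix (Fin 1) (Fin 1) E) 0 0 := fun σ => by
    change ((Matrix.GeneralLinearGroup.det (rE σ) : (E)ˣ) : E) = _
    rw [Matrix.GeneralLinearGroup.val_det_apply, Matrix.det_fin_one]
  have hψc : Continuous ψ := by
    have hmat : Continuous fun σ => ((rE σ : GL (Fin 1) E) : Matrix (Fin 1) (Fin 1) E) :=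
      Units.continuous_val.comp (map_continuous rE)
    have hval : Continuous fun σ => ((ψ σ : (E)ˣ) : E) :=
      (continuous_congr hψ00).2 (hmat.matrix_elem 0 0)
    refine Units.continuous_iff.2 ⟨hval, ?_⟩
    have : (fun σ => ((ψ σ)⁻¹ : (E)ˣ).val) = fun σ => ((ψ σ⁻¹ : (E)ˣ) : E) :=
      funext fun σ => by rw [map_inv]
    rw [this]
    exact hval.comp continuous_inv
  -- (3) `ψ = μ ν`, `μ` unramified, `ν = ν̃ ∘ χ_π`
  obtain ⟨μ, ν, hψμν, hμc, hνc, hμI, hνK, -⟩ := exists_unramified_mul_inertial hπ ψ hψc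
  obtain ⟨νt, hνtc, hνt⟩ := exists_continuous_unitsHom_eq_comp_lubinTateChar hπ ν hνc hνK
  -- (4) `log ν̃ = α ∘ log` near `1`
  obtain ⟨α, r₁, hr₁, -, hL⟩ := PadicField.exists_linearMap_plog_unitsHom_eq hp νt hνtc
  have hL1 : (letI := PadicField.normedField F p hp
      ∀ u : (𝒪[F])ˣ, ‖1 - ((u : 𝒪[F]) : F)‖ < r₁ →
        ‖1 - ((νt u : (E)ˣ) : E)‖ < 1 ∧
          PadicExp.plog ((νt u : (E)ˣ) : E) = α (PadicExp.plog ((u : 𝒪[F]) : F))) :=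
    fun u hu => ⟨(hL u hu).1.trans (rpow_radius_lt_one p), (hL u hu).2⟩
  -- (5) integrality of the `ι₀`-coefficient of `j ∘ α` for every `j : E → F̄`
  have hint : ∀ (j : E →ₐ[ℚ_[p]] AlgebraicClosure F)
      (c : (F →ₐ[ℚ_[p]] AlgebraicClosure F) → AlgebraicClosure F),
      j.toLinearMap ∘ₗ α = ∑ e, c e • (e : F →ₐ[ℚ_[p]] AlgebraicClosure F).toLinearMap →
        ∃ a : ℤ, c ι₀ = (a : AlgebraicClosure F) := by
    intro j c hc
    obtain ⟨nj, y, hy0, hyσ⟩ := hper j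
    obtain ⟨mj, z, hz0, hzσ⟩ := DeRhamRankOne.exists_theta_period_of_unramified' hp μ hμc hμI j
    set Y : K := (toC hp).symm y with hYdef
    set Z : K := (toC hp).symm z with hZdef
    have hY0 : Y ≠ 0 := (toC hp).symm.map_ne_zero_iff.2 hy0
    have hZ0 : Z ≠ 0 := (toC hp).symm.map_ne_zero_iff.2 hz0
    -- `Stab(j)` contains a cofinite level
    have hStab : EventuallyFix fun σ : absoluteGaloisGroup F => ∀ x : E, σ • j x = j x := by
      set bE := Module.finBasis ℚ_[p] E
      refine (EventuallyFix.forall_smul_eq' (fun i => j (bE i))).mono fun σ hσ x => ?_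
      rw [← bE.sum_repr x, map_sum, Finset.smul_sum]
      refine Finset.sum_congr rfl fun i _ => ?_
      rw [Algebra.smul_def, map_mul, j.commutes, smul_mul', hσ i,
        IsScalarTower.algebraMap_apply ℚ_[p] F (AlgebraicClosure F), absoluteGaloisGroup.smul_def,
        AlgEquiv.commutes]
    have hj : Function.Injective j := (j : E →+* AlgebraicClosure F).injective
    refine ⟨mj - nj, coeff_toAlgHom_eq_intCast hp (lubinTateCharHom hπ)
      (continuous_lubinTateCharHom hπ) νt hνtc α hr₁ hL1 j (mj - nj)
      (mul_ne_zero hY0 (inv_ne_zero hZ0)) (hStab.mono fun σ hσ => ?_) (fun e he => ?_) ?_ c hc⟩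
    · -- the semi-invariance of `Y Z⁻¹`
      set B : K := algebraMap ℚ_[p] K
        (((GaloisRep.cyclotomicCharacter F p σ : ℤ_[p]ˣ) : ℤ_[p]) : ℚ_[p]) with hBdef
      set Aμ : K := algClosureToK hp (j ((μ σ : (E)ˣ) : E)) with hAμdef
      set Aν : K := algClosureToK hp (j ((νt (lubinTateCharHom hπ σ) : (E)ˣ) : E)) with hAνdef
      show gal hp σ (Y * Z⁻¹) = Aν⁻¹ * B ^ (mj - nj) * (Y * Z⁻¹)
      have hB0 : B ≠ 0 := by
        rw [hBdef, map_ne_zero, Ne, PadicInt.coe_eq_zero]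
        exact (GaloisRep.cyclotomicCharacter F p σ).ne_zero
      have hAμ0 : Aμ ≠ 0 :=
        (map_ne_zero_iff _ (algClosureToK_injective hp)).2 ((map_ne_zero_iff _ hj).2 (μ σ).ne_zero)
      have hAν0 : Aν ≠ 0 :=
        (map_ne_zero_iff _ (algClosureToK_injective hp)).2 ((map_ne_zero_iff _ hj).2 (νt _).ne_zero)
      have hAψ : algClosureToK hp (j (((rE σ : GL (Fin 1) E) : Matrix (Fin 1) (Fin 1) E) 0 0)) =
          Aμ * Aν := by
        rw [← hψ00 σ, hψμν σ, hνt σ, Units.val_mul, map_mul, map_mul]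
        rfl
      have hY : Y = algClosureToK hp (j (((rE σ : GL (Fin 1) E) : Matrix (Fin 1) (Fin 1) E) 0 0)) *
          B ^ nj * gal hp σ Y := by
        apply (toC hp).injective
        rw [hYdef, RingEquiv.apply_symm_apply, map_mul, map_mul, map_zpow₀, toC_gal,
          RingEquiv.apply_symm_apply]
        exact hyσ σ hσ
      have hZ : Z = Aμ * B ^ mj * gal hp σ Z := by
        apply (toC hp).injective
        rw [hZdef, RingEquiv.apply_symm_apply, map_mul, map_mul, map_zpow₀, toC_gal,
          RingEquiv.apply_symm_apply]
        exact hzσ σ hσ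
      rw [hAψ] at hY
      have hgY : gal hp σ Y = (Aμ * Aν * B ^ nj)⁻¹ * Y := by
        rw [eq_inv_mul_iff_mul_eq₀ (mul_ne_zero (mul_ne_zero hAμ0 hAν0) (zpow_ne_zero _ hB0))]
        exact hY.symm
      have hgZ : gal hp σ Z = (Aμ * B ^ mj)⁻¹ * Z := by
        rw [eq_inv_mul_iff_mul_eq₀ (mul_ne_zero hAμ0 (zpow_ne_zero _ hB0))]
        exact hZ.symm
      rw [map_mul, map_inv₀, hgY, hgZ, zpow_sub₀ hB0]
      have hBn : B ^ nj ≠ 0 := zpow_ne_zero _ hB0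
      have hBm : B ^ mj ≠ 0 := zpow_ne_zero _ hB0
      field_simp
    · exact LubinTateLog.isGalCoboundary_plog_embedding_lubinTateChar hp hπ hH e he
    · exact LubinTateLog.isGalCoboundary_plog_cyclotomic_sub_plog_norm hp hπ
  -- (6) Galois descent over the embeddings: all coefficients of `j₀ ∘ α` are integers
  haveI : IsAlgClosure ℚ_[p] (AlgebraicClosure F) :=
    ⟨inferInstance, Algebra.IsAlgebraic.trans ℚ_[p] F (AlgebraicClosure F)⟩
  have hcard : Fintype.card (F →ₐ[ℚ_[p]] AlgebraicClosure F) = Module.finrank ℚ_[p] F :=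
    AlgHom.card ℚ_[p] F (AlgebraicClosure F)
  set J : AlgebraicClosure F ≃ₐ[ℚ_[p]] PadicAlgCl p :=
    IsAlgClosure.equiv ℚ_[p] (AlgebraicClosure F) (PadicAlgCl p) with hJ
  set j₀ : E →ₐ[ℚ_[p]] AlgebraicClosure F :=
    (J.symm : PadicAlgCl p →ₐ[ℚ_[p]] AlgebraicClosure F).comp E.val with hj₀
  obtain ⟨n, hn⟩ := exists_int_apply_eq_sum_of_forall_conj hcard ι₀
    (Set.range fun j : E →ₐ[ℚ_[p]] AlgebraicClosure F => j.toLinearMap ∘ₗ α)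
    (by rintro _ ⟨j, rfl⟩ γ; exact ⟨(γ : AlgebraicClosure F →ₐ[ℚ_[p]] AlgebraicClosure F).comp j, rfl⟩)
    (by rintro _ ⟨j, rfl⟩ c hc; exact hint j c hc) (α := j₀.toLinearMap ∘ₗ α) ⟨j₀, rfl⟩
  -- (7) exponentiate: `j₀(ν̃ u) = ∏_e e(u)^{n_e}` near `1`
  obtain ⟨ρ, hρ0, hρ1, hρ⟩ := PadicField.exists_radius_unitsHom_eq_prod_zpow hp νt hνtc α hr₁ hL1
    j₀ n (fun y => by rw [← hn y]; rfl)
  -- (8) packaging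
  set ι : (F →ₐ[ℚ_[p]] AlgebraicClosure F) → (F →+* PadicAlgCl p) := fun e =>
    ((J : AlgebraicClosure F →ₐ[ℚ_[p]] PadicAlgCl p).comp e : F →+* PadicAlgCl p) with hιdef
  have hιapp : ∀ e x, ι e x = J (e x) := fun e x => rfl
  have hιinj : Function.Injective ι := fun e e' h => by
    apply AlgHom.ext; intro x
    apply J.injective
    rw [← hιapp, ← hιapp, h]
  have hιc : ∀ e, Continuous (ι e) := fun e =>
    PadicField.continuous_ringHom_of_comp hp (A := PadicAlgCl p) (ι e) fun q => by
      rw [hιapp]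
      change J (e (algebraMap ℚ_[p] F q)) = _
      rw [e.commutes, J.commutes]
  refine ⟨PadicField.unitsBall hp ρ hρ0 hρ1, PadicField.isOpen_unitsBall hp hρ0 hρ1,
    Finset.univ.image ι, Function.extend ι n 0, ?_, fun w hw hV => ?_⟩
  · intro f hf
    obtain ⟨e, -, rfl⟩ := Finset.mem_image.1 hf
    exact hιc e
  set σ := WeilGroup.toAbsGalois F w with hσdef
  have hσI : σ ∈ absInertia F := WeilGroup.mem_inertia_iff.mp hw
  have hu : (((lubinTateChar hπ σ : (𝒪[F])ˣ) : 𝒪[F]) : F) = ((canonicalArtin F w : Fˣ) : F) :=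
    coe_lubinTateChar_toAbsGalois_canonicalArtin hπ hw
  have hball : (letI := PadicField.normedField F p hp
      ‖1 - (((lubinTateChar hπ σ : (𝒪[F])ˣ) : 𝒪[F]) : F)‖ < ρ) := by
    rw [hu]; exact hV
  have hid := hρ (lubinTateChar hπ σ) hball
  have halg : ∀ x : E, algebraMap E (PadicAlgCl p) x = J (j₀ x) := fun x => by
    rw [hj₀, AlgHom.comp_apply, AlgEquiv.coe_toAlgHom, AlgEquiv.apply_symm_apply]; rfl
  rw [hmodel σ, ← hψ00 σ, hψμν σ, hμI σ hσI, one_mul, hνt σ, halg,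
    Finset.prod_image fun e _ e' _ h => hιinj h]
  refine (congrArg J hid).trans ?_
  rw [map_prod]
  exact Finset.prod_congr rfl fun e _ => by rw [map_zpow₀, hιinj.extend_apply, hιapp, hu]

end Summit.Langlands.Langlands.Theorems

end
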